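import Summits.CriticalPhenomena.PercolationContinuityZ3.Theorems.PercNearOneGluingNoHeavyQuantLongTailHub
import HarnessLib

/-!
# QUANT lane R8, T-DEC: the long-tail sub-floor hub in the WIDTH WINDOW `K < lo·j < 2K` (near-one gates) is SDEC
# (census-1 gen 31; complements `sdec_sHub_long` / `sdec_sHub_long_half`, which need `2K ≤ lo·j`)

builds on p205010 (kernel theorem, internal audit signed; external expert review pending)

Support file (`--supports stmt-CriticalPhenomena-4575`), QUANT lane seat prim-quant-census-1 (gen 31); memo
`run/shared/lean/prim/quant/prim-quant-census-1/g31/HUB-GENERAL-G31.md` §0 (7)(f).  Theorems only, standard axioms, no sorries.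

THE POINT.  Below the width `2K/lo` the farthest-near rule meets rows with `r = t* − 2s = 1` (the top charged row at `T` close to an atom), where
the capacity is nearly TIGHT (memo §0 (7): e.g. (1,5), j = 8, gates 0.969: ratio 38.75 needed 37.4) and no universal certificate exists; but for
NEAR-ONE gates it does.  `sdec_sHub_window`: `lo < K`, `3lo ≤ 2K`, `K < lo·j`, `0 < x`, and every gate `γ` satisfies `γ < 1`, `x(lo+K) ≤ lo + Kγ`,
**`K(1−γ) ≤ γ`** (odds `≥ K`) and **`lo·j·(1−γ) ≤ (2K − lo·j)·γ`** (odds `≥ lo·j/(2K − lo·j)`, i.e. `γ ≥ lo·j/(2K)`; this forces `lo·j < 2K`)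
⟹ `SDEC x ((lo+K)j) (sHub lo K P)`.  E.g. the residue sample `R²[½](R⁹[.99])` (shape (2,9), odds 99): every width `5 ≤ j ≤ 8` (and `j ≥ 9` by
`sdec_sHub_long`).  PROOF.  With `c = max(K/(K+1), lo·j/(2K), (x(lo+K)−lo)/K) ≤ γᵢ`, `ω = c/(1−c) ≥ max(K, lo·j/(2K−lo·j), 2)` and the route bound
`u_s·C(j−s,r)ω^r ≤ C(s+r,s)·u_{s+r}` (`sHub_routeBound_nearOne'`): rows with `r ≥ 2` take `B = ω^r ≥ K^r ≥ Kr − 1 ≥ ρ/(1−ρ)` (`D ≤ K(r+1) − lo·j ≤ Kr − 1`)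
and the floor part of `…QuantLongTailHub`; rows with `r = 1` take `B = (j−s)ω/(s+1)`: credit `ρ ≤ (2K−lo·j)/K ≤ (K−1)/K`, `B ≥ ω ≥ K`; floor
`x(1+B) ≤ B ⟸ (lo+Kc)(s+1) ≤ Kc(j−s) ⟸ lo(s+1) ≤ Kc·(j−2s−1)`, `j − 2s − 1 = j − t* ≥ 1`, `2(s+1) ≤ j`, `lo·j ≤ 2Kc`.

HONEST STATUS.  Hub-level; smallest widths `lo·j ≤ K` (no near route) and the long-tail forest expansion remain open (memo §3 item 2).
`SiblingStep`, `GluedDominated'`, `SDECConvClosed`, `FarTreeRow` OPEN; RATE class (log\*) / honest sentence of `run/shared/lean/prim/quant/README.md`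
unchanged.  [this work].  Nothing here is cited as a published result.  The gluing rows served [cite: KozmaNitzan2024, Conjecture 3 (p. 15)]; product
measure [cite: Grimmett1999, §1.3 p. 10].
-/

noncomputable section

open scoped BigOperators

namespace Summit.CriticalPhenomena.PercolationContinuityZ3.Theorems
namespace Quant
namespace LawDec

open Finset

/-- `2r ≤ 2^r` for `r ≥ 1`. [this work] -/
theorem two_mul_le_two_pow : ∀ r : ℕ, 1 ≤ r → 2 * r ≤ 2 ^ r
  | 0, h => by omega
  | 1, _ => by norm_num
  | r + 2, _ => by
    have := two_mul_le_two_pow (r + 1) (by omega)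
    rw [pow_succ]; omega

/-- `K·r ≤ K^r` for `K ≥ 2`, `r ≥ 1` (reals). [this work] -/
theorem mul_le_pow_of_two_le (K : ℝ) (hK : 2 ≤ K) : ∀ r : ℕ, 1 ≤ r → K * r ≤ K ^ r
  | 0, h => by omega
  | r + 1, _ => by
    rcases Nat.eq_zero_or_pos r with h0 | hr
    · subst h0; simp
    · have IH := mul_le_pow_of_two_le K hK r hr
      have hr1 : (1 : ℝ) ≤ r := by exact_mod_cast hr
      rw [pow_succ]; push_cast
      nlinarith [pow_nonneg (by linarith : (0 : ℝ) ≤ K) r]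

/-- credit part in the window: `D ≤ Kr − 1`, `Kr − 1 ≤ B` ⟹ `(D/(Kr))(1+B) ≤ B`. [this work] -/
theorem window_credit_part {D K r B : ℝ} (hK : 0 < K) (hr : 1 ≤ r) (hD : D ≤ K * r - 1) (hB : K * r - 1 ≤ B) :
    D / (K * r) * (1 + B) ≤ B := by
  have hKr : 0 < K * r := by nlinarith
  have hB0 : 0 ≤ 1 + B := by nlinarith
  rw [div_mul_eq_mul_div, div_le_iff₀ hKr]
  nlinarith [mul_le_mul_of_nonneg_right hD hB0]

/-- floor part for a row with `r = 1`: `x(lo+K) ≤ lo + Kc`, `c < 1`, `(lo + Kc)(s+1) ≤ Kc·n`, `B = nω/(s+1)`, `ω = c/(1−c)` ⟹ `x(1+B) ≤ B`.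
[this work] -/
theorem window_floor_r1 (lo K x c n s1 : ℝ) (hlo : 0 ≤ lo) (hK : 0 < K) (hc0 : 0 < c) (hc1 : c < 1) (hs1 : 0 < s1)
    (hx : x * (lo + K) ≤ lo + K * c) (hkey : (lo + K * c) * s1 ≤ K * c * n) :
    x * (1 + n * (c / (1 - c)) / s1) ≤ n * (c / (1 - c)) / s1 := by
  have h1c : 0 < 1 - c := by linarith
  have hloK : 0 < lo + K := by linarith
  -- `B·K(1−c) = K c n / s1 ≥ lo + Kc`
  set B : ℝ := n * (c / (1 - c)) / s1 with hB
  have hBK : B * (K * (1 - c)) * s1 = K * c * n := by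
    rw [hB]; field_simp
  have hB1 : lo + K * c ≤ B * (K * (1 - c)) := by
    have : (lo + K * c) * s1 ≤ B * (K * (1 - c)) * s1 := by rw [hBK]; exact hkey
    exact le_of_mul_le_mul_right this hs1
  have hn : 0 < n := by
    have h : 0 < K * c * n := lt_of_lt_of_le (by positivity) hkey
    exact pos_of_mul_pos_right h (by positivity)
  have hB0 : 0 ≤ B := by rw [hB]; positivity
  -- `x(lo+K)(1+B) ≤ (lo+Kc)(1+B) ≤ B(lo+K)`
  have h2 : (lo + K * c) * (1 + B) ≤ B * (lo + K) := by nlinarith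
  have h3 : x * (1 + B) * (lo + K) ≤ B * (lo + K) := by nlinarith [mul_le_mul_of_nonneg_right hx (by linarith : (0 : ℝ) ≤ 1 + B)]
  exact le_of_mul_le_mul_right h3 hloK

/-- capacity of a row with `r = 1` in the window (near-one gates bounded below by `c`, `lo·j ≤ 2Kc`, odds `ω ≥ K`). [this work] -/
theorem window_rowcap_one (lo K : ℕ) (hloK : lo < K) (x c T : ℝ) (P : List ℝ) (t s r : ℕ) (hr : r = 1)
    (hPh : ∀ γ ∈ P, 1 / 2 ≤ γ ∧ γ < 1) (hcP : ∀ γ ∈ P, c ≤ γ) (hK0 : (0 : ℝ) < K) (hc0 : 0 < c) (hc12 : 1 / 2 ≤ c) (hc1 : c < 1)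
    (hKc : x * ((lo : ℝ) + K) ≤ lo + K * c) (hWc : (lo : ℝ) * P.length ≤ 2 * K * c) (hωK : (K : ℝ) ≤ c / (1 - c))
    (hts : t = 2 * s + r) (htj : t < P.length) (hD : T - 2 * ((lo : ℝ) * P.length + K * s) ≤ K * (r : ℝ) - 1) :
    max x ((T - 2 * ((lo : ℝ) * P.length + K * s)) / ((K : ℝ) * (r : ℝ)))
        * (sHub lo K P (lo * P.length + K * s) + sHub lo K P (lo * P.length + K * (s + r)))
      ≤ sHub lo K P (lo * P.length + K * (s + r)) := by
  subst hr
  have hlo0 : (0 : ℝ) ≤ lo := Nat.cast_nonneg lo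
  have h1c : 0 < 1 - c := by linarith
  have hω0 : 0 ≤ c / (1 - c) := div_nonneg hc0.le h1c.le
  have hsj : s < P.length := by omega
  have hP01 : ∀ γ ∈ P, 0 ≤ γ ∧ γ ≤ 1 := fun γ hγ => ⟨by linarith [(hPh γ hγ).1], (hPh γ hγ).2.le⟩
  have h0 := (sHub_laws lo K P hP01).1
  have hu0 : 0 ≤ sHub lo K P (lo * P.length + K * s) := h0 _
  have hRB := sHub_routeBound_nearOne' lo K hloK P hPh s 1 hsj c hc12 hc1 hcP
  have hn1 : (((P.length - s).choose 1 : ℕ) : ℝ) = ((P.length - s : ℕ) : ℝ) := by rw [Nat.choose_one_right]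
  have hs1 : (((s + 1).choose s : ℕ) : ℝ) = (s : ℝ) + 1 := by
    rw [Nat.choose_symm_add, Nat.choose_one_right]; push_cast; ring
  rw [hn1, pow_one, hs1] at hRB
  set n : ℝ := ((P.length - s : ℕ) : ℝ) with hn
  have hnR : n = (P.length : ℝ) - s := by rw [hn, Nat.cast_sub hsj.le]
  have hCpos : (0 : ℝ) < (s : ℝ) + 1 := by positivity
  set B : ℝ := n * (c / (1 - c)) / ((s : ℝ) + 1) with hB
  have hb : B * sHub lo K P (lo * P.length + K * s) ≤ sHub lo K P (lo * P.length + K * (s + 1)) := by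
    have : ((s : ℝ) + 1) * (B * sHub lo K P (lo * P.length + K * s)) ≤ ((s : ℝ) + 1) * sHub lo K P (lo * P.length + K * (s + 1)) := by
      have e : ((s : ℝ) + 1) * (B * sHub lo K P (lo * P.length + K * s))
          = sHub lo K P (lo * P.length + K * s) * (n * (c / (1 - c))) := by
        rw [hB]; field_simp
      rw [e]; exact hRB
    exact le_of_mul_le_mul_left this hCpos
  have hns : (s : ℝ) + 1 + 1 ≤ n := by
    rw [hnR]
    have : ((2 * s + 1 + 1 : ℕ) : ℝ) ≤ P.length := by exact_mod_cast (by omega : 2 * s + 1 + 1 ≤ P.length)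
    push_cast at this; linarith [Nat.cast_nonneg (α := ℝ) s]
  have hBω : c / (1 - c) ≤ B := by
    rw [hB, le_div_iff₀ hCpos, mul_comm n _]
    exact mul_le_mul_of_nonneg_left (by linarith) hω0
  have hB0 : 0 ≤ B := le_trans hω0 hBω
  -- credit
  have hρ : (T - 2 * ((lo : ℝ) * P.length + K * s)) / ((K : ℝ) * ((1 : ℕ) : ℝ)) * (1 + B) ≤ B := by
    refine window_credit_part hK0 (by norm_num) hD ?_
    push_cast; linarith
  -- floor: `(lo + Kc)(s+1) ≤ Kc·n`
  have h2s : 2 * ((s : ℝ) + 1) ≤ P.length := by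
    have : ((2 * s + 2 : ℕ) : ℝ) ≤ P.length := by exact_mod_cast (by omega : 2 * s + 2 ≤ P.length)
    push_cast at this; linarith
  have hKc0 : 0 ≤ (K : ℝ) * c := by positivity
  have p1 : 2 * ((lo : ℝ) * ((s : ℝ) + 1)) ≤ lo * P.length :=
    calc 2 * ((lo : ℝ) * ((s : ℝ) + 1)) = lo * (2 * ((s : ℝ) + 1)) := by ring
      _ ≤ lo * P.length := mul_le_mul_of_nonneg_left h2s hlo0
  have hl1 : (lo : ℝ) * ((s : ℝ) + 1) ≤ K * c := by linarith [p1, hWc]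
  have hkey : ((lo : ℝ) + K * c) * ((s : ℝ) + 1) ≤ K * c * n :=
    calc ((lo : ℝ) + K * c) * ((s : ℝ) + 1) = lo * ((s : ℝ) + 1) + K * c * ((s : ℝ) + 1) := by ring
      _ ≤ K * c + K * c * ((s : ℝ) + 1) := by linarith [hl1]
      _ = K * c * ((s : ℝ) + 1 + 1) := by ring
      _ ≤ K * c * n := mul_le_mul_of_nonneg_left hns hKc0
  have hxB : x * (1 + B) ≤ B := by
    have := window_floor_r1 lo K x c n ((s : ℝ) + 1) hlo0 hK0 hc0 hc1 hCpos hKc hkey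
    simpa [hB] using this
  have huh0 : 0 ≤ sHub lo K P (lo * P.length + K * (s + 1)) := h0 _
  rw [max_mul_of_nonneg _ _ (add_nonneg hu0 huh0)]
  exact max_le (cap_of_ratio hB0 hxB hu0 hb) (cap_of_ratio hB0 hρ hu0 hb)

/-- capacity of a row with `r ≥ 2` in the window (gates `≥ c ≥ 2/3`, odds `ω ≥ K ≥ 2`, `3lo ≤ 2K`). [this work] -/
theorem window_rowcap_two (lo K : ℕ) (hloK : lo < K) (h32R : 3 * (lo : ℝ) ≤ 2 * K) (hK2R : (2 : ℝ) ≤ K) (x c T : ℝ) (P : List ℝ)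
    (t s r : ℕ) (hr2 : 2 ≤ r)
    (hPh : ∀ γ ∈ P, 1 / 2 ≤ γ ∧ γ < 1) (hcP : ∀ γ ∈ P, c ≤ γ) (hK0 : (0 : ℝ) < K) (hc23 : 2 / 3 ≤ c) (hc1 : c < 1) (hx1 : x < 1)
    (hKc : x * ((lo : ℝ) + K) ≤ lo + K * c) (hωK : (K : ℝ) ≤ c / (1 - c))
    (hts : t = 2 * s + r) (htj : t < P.length) (hD : T - 2 * ((lo : ℝ) * P.length + K * s) ≤ K * (r : ℝ) - 1) :
    max x ((T - 2 * ((lo : ℝ) * P.length + K * s)) / ((K : ℝ) * (r : ℝ)))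
        * (sHub lo K P (lo * P.length + K * s) + sHub lo K P (lo * P.length + K * (s + r)))
      ≤ sHub lo K P (lo * P.length + K * (s + r)) := by
  have hlo0 : (0 : ℝ) ≤ lo := Nat.cast_nonneg lo
  have h1c : 0 < 1 - c := by linarith
  set ω : ℝ := c / (1 - c) with hω
  have hω0 : 0 ≤ ω := div_nonneg (by linarith) h1c.le
  have hsj : s < P.length := by omega
  have hP01 : ∀ γ ∈ P, 0 ≤ γ ∧ γ ≤ 1 := fun γ hγ => ⟨by linarith [(hPh γ hγ).1], (hPh γ hγ).2.le⟩
  have h0 := (sHub_laws lo K P hP01).1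
  have hu0 : 0 ≤ sHub lo K P (lo * P.length + K * s) := h0 _
  have huh0 : 0 ≤ sHub lo K P (lo * P.length + K * (s + r)) := h0 _
  have hRB := sHub_routeBound_nearOne' lo K hloK P hPh s r hsj c (by linarith) hc1 hcP
  have eCsym : (s + r).choose s = (s + r).choose r := Nat.choose_symm_add
  rw [eCsym] at hRB
  have hCpos : (0 : ℝ) < (((s + r).choose r : ℕ) : ℝ) := by exact_mod_cast Nat.choose_pos (by omega)
  have hchoose : (((s + r).choose r : ℕ) : ℝ) ≤ (((P.length - s).choose r : ℕ) : ℝ) := by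
    exact_mod_cast Nat.choose_le_choose r (by omega : s + r ≤ P.length - s)
  have hωr : 0 ≤ ω ^ r := pow_nonneg hω0 r
  have hb : ω ^ r * sHub lo K P (lo * P.length + K * s) ≤ sHub lo K P (lo * P.length + K * (s + r)) := by
    have h1 : sHub lo K P (lo * P.length + K * s) * ((((s + r).choose r : ℕ) : ℝ) * ω ^ r)
        ≤ sHub lo K P (lo * P.length + K * s) * ((((P.length - s).choose r : ℕ) : ℝ) * ω ^ r) :=
      mul_le_mul_of_nonneg_left (mul_le_mul_of_nonneg_right hchoose hωr) hu0
    have h2 := le_trans h1 hRB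
    have h3 : (((s + r).choose r : ℕ) : ℝ) * (ω ^ r * sHub lo K P (lo * P.length + K * s))
        ≤ (((s + r).choose r : ℕ) : ℝ) * sHub lo K P (lo * P.length + K * (s + r)) := by
      have e : sHub lo K P (lo * P.length + K * s) * ((((s + r).choose r : ℕ) : ℝ) * ω ^ r)
          = (((s + r).choose r : ℕ) : ℝ) * (ω ^ r * sHub lo K P (lo * P.length + K * s)) := by ring
      rw [← e]; exact h2
    exact le_of_mul_le_mul_left h3 hCpos
  have hr1 : 1 ≤ r := by omega
  have hr1R : (1 : ℝ) ≤ r := by exact_mod_cast hr1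
  have hωr2 : ω ^ 2 ≤ ω ^ r := pow_le_pow_right₀ (by linarith) hr2
  have hKr : (K : ℝ) * r - 1 ≤ ω ^ r :=
    calc (K : ℝ) * r - 1 ≤ (K : ℝ) * r := by linarith
      _ ≤ (K : ℝ) ^ r := mul_le_pow_of_two_le K hK2R r hr1
      _ ≤ ω ^ r := pow_le_pow_left₀ hK0.le hωK r
  have hxω2 : x * (1 + ω ^ 2) ≤ ω ^ 2 := longTail_floor_part lo K x c hlo0 hK0 h32R hc23 hc1 hKc
  have hxB : x * (1 + ω ^ r) ≤ ω ^ r := cap_ratio_mono hxω2 hωr2 hx1.le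
  have hρ : (T - 2 * ((lo : ℝ) * P.length + K * s)) / ((K : ℝ) * (r : ℝ)) * (1 + ω ^ r) ≤ ω ^ r :=
    window_credit_part hK0 hr1R hD hKr
  rw [max_mul_of_nonneg _ _ (add_nonneg hu0 huh0)]
  exact max_le (cap_of_ratio hωr hxB hu0 hb) (cap_of_ratio hωr hρ hu0 hb)

/-- **the long-tail hub in the width window** (`lo < K`, `3lo ≤ 2K`, `K < lo·j`, near-one gates: `γ < 1`, `K(1−γ) ≤ γ`,
`lo·j·(1−γ) ≤ (2K − lo·j)γ`, `x(lo+K) ≤ lo + Kγ`; `0 < x`): `SDEC x ((lo+K)j) (sHub lo K P)`. [this work] -/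
theorem sdec_sHub_window (lo K : ℕ) (hloK : lo < K) (h32 : 3 * lo ≤ 2 * K) (x : ℝ) (hx0 : 0 < x) (P : List ℝ)
    (hjK : K < lo * P.length)
    (hP : ∀ γ ∈ P, γ < 1 ∧ (K : ℝ) * (1 - γ) ≤ γ ∧ (lo : ℝ) * P.length * (1 - γ) ≤ (2 * (K : ℝ) - lo * P.length) * γ ∧
      x * ((lo : ℝ) + K) ≤ lo + K * γ) :
    SDEC x ((lo + K) * P.length) (sHub lo K P) := by
  have hK : 0 < K := lt_of_le_of_lt (Nat.zero_le lo) hloK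
  have hK2 : 2 ≤ K := by
    rcases Nat.eq_zero_or_pos lo with h0 | h0
    · subst h0; simp at hjK
    · omega
  have hK0 : (0 : ℝ) < K := by exact_mod_cast hK
  have hK2R : (2 : ℝ) ≤ K := by exact_mod_cast hK2
  have hlo0 : (0 : ℝ) ≤ lo := Nat.cast_nonneg lo
  have h32R : 3 * (lo : ℝ) ≤ 2 * K := by exact_mod_cast h32
  have hjKR : (K : ℝ) + 1 ≤ (lo : ℝ) * P.length := by
    have : K + 1 ≤ lo * P.length := hjK
    exact_mod_cast this
  have hPne : P ≠ [] := by
    intro h; rw [h] at hjK; simp at hjK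
  have hP23 : ∀ γ ∈ P, 2 / 3 ≤ γ := by
    intro γ hγ
    have h := (hP γ hγ).2.1
    nlinarith
  have hPh : ∀ γ ∈ P, 1 / 2 ≤ γ ∧ γ < 1 := fun γ hγ => ⟨by linarith [hP23 γ hγ], (hP γ hγ).1⟩
  have hP01 : ∀ γ ∈ P, 0 ≤ γ ∧ γ ≤ 1 := fun γ hγ => ⟨by linarith [hP23 γ hγ], (hP γ hγ).1.le⟩
  obtain ⟨h0, hM, h1, hmean⟩ := sHub_laws lo K P hP01
  rw [sum_map_affine] at hmean
  obtain ⟨γ₁, hγ₁⟩ := List.exists_mem_of_ne_nil P hPne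
  have hj2K : (lo : ℝ) * P.length < 2 * K := by
    have h := (hP γ₁ hγ₁).2.2.1
    have hγ := (hP γ₁ hγ₁).1
    nlinarith
  have hx1 : x < 1 := by
    have h := (hP γ₁ hγ₁).2.2.2
    have hγ1 : (lo : ℝ) + K * γ₁ < lo + K := by nlinarith [(hP γ₁ hγ₁).1]
    have hloK0 : (0 : ℝ) < lo + K := by linarith
    by_contra hx
    push Not at hx
    have : (lo : ℝ) + K ≤ x * (lo + K) := by nlinarith
    linarith
  have hta : x * (((lo + K) * P.length : ℕ) : ℝ) ≤ (lo : ℝ) * P.length + K * P.sum := by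
    have hs := le_sum_of_forall_le ((x * ((lo : ℝ) + K) - lo) / K) P (fun γ hγ => by
      rw [div_le_iff₀ hK0]; linarith [(hP γ hγ).2.2.2])
    have e : (x * ((lo : ℝ) + K) - lo) / K * (P.length : ℝ) * K = (x * ((lo : ℝ) + K) - lo) * P.length := by
      field_simp
    have hs' : (x * ((lo : ℝ) + K) - lo) * (P.length : ℝ) ≤ K * P.sum := by
      have := mul_le_mul_of_nonneg_right hs hK0.le
      rw [e] at this; linarith
    push_cast
    have e2 : x * (((lo : ℝ) + K) * P.length) = (x * ((lo : ℝ) + K) - lo) * P.length + lo * P.length := by ring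
    rw [e2]; linarith
  have hΛj : P.sum < P.length := (sum_bounds_nearOne P hPh).2 hPne
  have hΛ0 : (P.length : ℝ) / 2 ≤ P.sum := (sum_bounds_nearOne P hPh).1
  have hT0pos : 0 < (lo : ℝ) * P.length + K * P.sum := by
    have : (0 : ℝ) < K * P.sum := mul_pos hK0 (by linarith)
    linarith
  have hsupp : ∀ h, sHub lo K P h ≠ 0 → ∃ s, h = lo * P.length + K * s := by
    intro h hh
    obtain ⟨s, hs, _⟩ := (sHub_struct lo K hloK 0 le_rfl P (fun γ hγ => ⟨(hP01 γ hγ).1, (hP01 γ hγ).2, by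
      rw [zero_mul]; exact (hP01 γ hγ).1⟩)).1 h hh
    exact ⟨s, hs⟩
  -- the common gate bound `c` and odds `ω ≥ K`
  set c : ℝ := max ((K : ℝ) / (K + 1)) (max ((lo : ℝ) * P.length / (2 * K)) ((x * ((lo : ℝ) + K) - lo) / K)) with hc
  have hcK : (K : ℝ) / (K + 1) ≤ c := le_max_left _ _
  have hcW : (lo : ℝ) * P.length / (2 * K) ≤ c := le_trans (le_max_left _ _) (le_max_right _ _)
  have hcx : (x * ((lo : ℝ) + K) - lo) / K ≤ c := le_trans (le_max_right _ _) (le_max_right _ _)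
  have hc1 : c < 1 := by
    rw [hc, max_lt_iff, max_lt_iff]
    refine ⟨by rw [div_lt_iff₀ (by linarith)]; linarith, ?_, ?_⟩
    · rw [div_lt_iff₀ (by linarith)]; linarith
    · rw [div_lt_iff₀ hK0]; nlinarith
  have hcP : ∀ γ ∈ P, c ≤ γ := fun γ hγ => by
    obtain ⟨hγ1, hKγ, hWγ, hxγ⟩ := hP γ hγ
    rw [hc, max_le_iff, max_le_iff]
    refine ⟨?_, ?_, ?_⟩
    · rw [div_le_iff₀ (by linarith)]; linarith
    · rw [div_le_iff₀ (by linarith)]; nlinarith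
    · rw [div_le_iff₀ hK0]; linarith
  have hc23 : 2 / 3 ≤ c := by
    have : (2 : ℝ) / 3 ≤ (K : ℝ) / (K + 1) := by rw [div_le_div_iff₀ (by norm_num) (by linarith)]; linarith
    linarith
  have hc0 : 0 < c := by linarith
  have h1c : 0 < 1 - c := by linarith
  have hωK : (K : ℝ) ≤ c / (1 - c) := by
    rw [le_div_iff₀ h1c]
    have := hcK; rw [div_le_iff₀ (by linarith)] at this; linarith
  have hKc : x * ((lo : ℝ) + K) ≤ lo + K * c := by
    have := hcx; rw [div_le_iff₀ hK0] at this; linarith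
  have hWc : (lo : ℝ) * P.length ≤ 2 * K * c := by
    have := hcW; rw [div_le_iff₀ (by linarith)] at this; linarith
  refine sdec_farthestNear lo K P.length x ((lo : ℝ) * P.length + K * P.sum) (sHub lo K P) hK (by omega) hx0 hx1 h0 hM h1 hmean
    hT0pos hta hsupp ?_
  intro T hTpos hTle t s hKt hTc h2s hlT _hμl
  set r : ℕ := t - 2 * s with hr
  have hts : t - s = s + r := by omega
  have hts' : t = 2 * s + r := by omega
  have hrR : ((r : ℕ) : ℝ) = (t : ℝ) - 2 * s := by
    rw [hr, Nat.cast_sub h2s.le]; push_cast; ring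
  have hD : T - 2 * ((lo : ℝ) * P.length + K * s) ≤ K * (r : ℝ) - 1 := by
    have : T - 2 * ((lo : ℝ) * P.length + K * s) ≤ K * ((r : ℝ) + 1) - lo * P.length := by rw [hrR]; linarith
    linarith
  have hΛt : (t : ℝ) < P.sum := by
    have h1' : (K : ℝ) * t < K * P.sum := by linarith
    exact lt_of_mul_lt_mul_left h1' hK0.le
  have htj : t < P.length := by
    have : (t : ℝ) < P.length := by linarith
    exact_mod_cast this
  rw [hts]
  by_cases hr_one : r = 1
  · exact window_rowcap_one lo K hloK x c T P t s r hr_one hPh hcP hK0 hc0 (by linarith) hc1 hKc hWc hωK hts' htj hD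
  · exact window_rowcap_two lo K hloK h32R hK2R x c T P t s r (by omega) hPh hcP hK0 hc23 hc1 hx1 hKc hωK hts' htj hD

/-- **every width above `K/lo` for near-one gates**: `lo < K`, `3lo ≤ 2K`, `K < lo·j`, gates with `γ < 1`, odds `≥ K` (`K(1−γ) ≤ γ`),
the window condition `lo·j(1−γ) ≤ (2K − lo·j)γ` WHEN `lo·j < 2K`, and `x(lo+K) ≤ lo + Kγ`, `0 < x` ⟹ `SDEC x ((lo+K)j) (sHub lo K P)`
(the window theorem below `2K`, `sdec_sHub_long` from `2K` on). [this work] -/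
theorem sdec_sHub_nearOne (lo K : ℕ) (hloK : lo < K) (h32 : 3 * lo ≤ 2 * K) (x : ℝ) (hx0 : 0 < x) (P : List ℝ)
    (hjK : K < lo * P.length)
    (hP : ∀ γ ∈ P, γ < 1 ∧ (K : ℝ) * (1 - γ) ≤ γ ∧
      ((lo : ℝ) * P.length < 2 * K → (lo : ℝ) * P.length * (1 - γ) ≤ (2 * (K : ℝ) - lo * P.length) * γ) ∧
      x * ((lo : ℝ) + K) ≤ lo + K * γ) :
    SDEC x ((lo + K) * P.length) (sHub lo K P) := by
  by_cases hw : (lo : ℝ) * P.length < 2 * K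
  · exact sdec_sHub_window lo K hloK h32 x hx0 P hjK
      (fun γ hγ => ⟨(hP γ hγ).1, (hP γ hγ).2.1, (hP γ hγ).2.2.1 hw, (hP γ hγ).2.2.2⟩)
  · push Not at hw
    have hj : 2 * K ≤ lo * P.length := by exact_mod_cast hw
    have hK2 : 2 ≤ K := by
      rcases Nat.eq_zero_or_pos lo with h0 | h0
      · subst h0; simp at hjK
      · omega
    have hK2R : (2 : ℝ) ≤ K := by exact_mod_cast hK2
    refine sdec_sHub_long lo K hloK h32 x hx0 P hj (fun γ hγ => ⟨?_, (hP γ hγ).1, (hP γ hγ).2.2.2⟩)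
    have h := (hP γ hγ).2.1
    nlinarith

end LawDec
end Quant
end Summit.CriticalPhenomena.PercolationContinuityZ3.Theorems
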